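import Literature.IUT.HodgeArakelov.IotaInvariantThetaInfty
import Literature.IUT.HodgeArakelov.EtaleThetaDataOfSetting
import Literature.AnabelianGeometry.EtaleTheta.ContH1ResInjective
import Literature.AnabelianGeometry.EtaleTheta.ContH1Lemmas

/-!
# [IUTchII] Prop 2.2 (ii) «respectively» clause AT THE MODEL `Π_v := Π^tp_X̲̲`: the input
# `Ker(H¹(Π_Ÿ(Π_v), (l·Δ_Θ)(Π_v)) → lim_J)` is torsion — DISCHARGED by inflation–restriction
# (proof-only companion of `IotaInvariantThetaInfty.lean`, abc-iut cell, SUBDAG W6-S4 row Prop-22.ii.r13a)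

S. Mochizuki, *Inter-universal Teichmüller theory II*, kurims manuscript (Dec. 2020) §2, Prop. 2.2 (ii) p. 66
l. 56–61 [claim: Mochizuki2012, status: disputed]; [IUTchII] Prop. 1.4 p. 27 ("`J` ranges over the finite index open
subgroups of `Π`"). `IotaInvariantThetaInfty.lean` (abc-iut-w5-d187, p413770) typed the «respectively» clause
(`IotaInvariantTheta'.InftyClause`: `∞θ^ι(Π_v)` is ONE `μ`-orbit within each `{(l·ℤ) × μ}`-orbit of `∞θ(Π_v)`) and
proved it modulo two interface-level binders: `hker` — the kernel of `H¹(Π_Ÿ(Π_v), (l·Δ_Θ)(Π_v)) → lim_J H¹(Π_Ÿ|_J, ·)`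
is torsion — and `hdiv` — the classes of `θ(Π_v)` are divisible in the limit. THIS FILE discharges `hker` at the
model `D := etaleThetaDataOfSetting'` of abc-iut-L6-t1 (`coh := cohomologySystemOfContH1 …`, REAL continuous
cohomology, `EtaleThetaDataOfSetting.lean` p411758/p412136), in the strong form "the map to the limit is INJECTIVE":

* `toLim_injective_of_res_injective` (any instantiated system `cohomologySystemOfContH1 φ A H`, any finite-index
  open `J`): `toLim J : H1 J → lim` is injective as soon as every restriction `H¹(H ⊓ J, A) → H¹(H ⊓ K, A)`,
  `K ⊆ J` finite-index open, is — a directed colimit whose transition maps out of the index `J` are injective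
  embeds that level (`AddCommGroup.DirectLimit.of.zero_exact` + abc-iut-L6-t1's `toLim_h1Equiv_symm`);
* `res_injective_of_forall_finiteIndex_fixed_eq_one`: … which holds when no element of `A` other than `1` is
  fixed by `H ⊓ K'` for any FINITE-INDEX `K'` (inflation–restriction, abc-iut-w4-d041's
  `ContH1.res_injective_of_forall_fixed_eq_one`, [cite: NeukirchSchmidtWingberg2008, I §6], applied to the
  NORMAL CORE `K₀ ⊴ Π` of `K` — `H ⊓ K₀ ⊴ H ⊓ J` — and functoriality `ContH1.res_res`);
* `toLim_top_injective_of_forall_fixed_eq_one`: hence `toLim ⊤` is injective under that fixed-point hypothesis;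
* **`inftyClause_etaleThetaDataOfSetting'`** — **IUTchII:Prop2.2(ii)** «respectively» clause at the model:
  `InftyClause` holds for every `IotaInvariantTheta'` datum over `etaleThetaDataOfSetting'`, given (hfix) the
  cyclotome `(l·Δ_Θ)(Π_v)` has no nontrivial element fixed by `Π_Ÿ(Π_v) ∩ K'` for any finite-index `K' ≤ Π_v`
  (finitely many roots of unity in a finite extension of `K_v`; the cyclotomic character is nontrivial on every
  open subgroup — the SAME by-name input as abc-iut-w4-d041's `h1LimRestrict_injective_of_forall_fixed_eq_one`,
  here over all finite-index `K'`) and (hdiv) divisibility of the classes of `θ(Π_v)` in `lim_J` (Kummer theory: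
  roots of `Θ̲̈` exist on finite étale coverings; L2 input); `inftyClause_uniqueness_etaleThetaDataOfSetting'` —
  clauses (1)(2) from (hfix) alone.

No definitions; no statement of [EtTh]/[IUTchII] asserted; typed ≠ proved for (hfix)/(hdiv); nothing here bears
on the disputed [IUTchIII] Cor. 3.12.
-/

namespace Literature.IUT.HodgeArakelov

open Literature.AnabelianGeometry.EtaleTheta CohomologySystemOfContH1

universe u

noncomputable section

/-! ## Injectivity of `toLim` for the instantiated cohomology systems -/

section ToLim

variable {P : TopGroup.{u}} {G' : Type u} [Group G'] [TopologicalSpace G'] [IsTopologicalGroup G']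
  (φ : P →* G') (A : Subgroup G') [A.Normal] [IsMulCommutative A] (H : Subgroup P)

/-- In the instantiated system `cohomologySystemOfContH1 φ A H` ([IUTchII] Prop. 1.4 p. 27: `J ↦ H¹(H|_J, A)`,
`lim_J`), the canonical map `toLim J : H1 J → lim` at a finite-index open `J` is INJECTIVE as soon as every
restriction `H¹(H ⊓ J, A) → H¹(H ⊓ K, A)` to a finite-index open `K ⊆ J` is: the directed colimit embeds a level
all of whose outgoing transition maps are injective. [cite: Mochizuki2012, Prop 1.4 p.27] -/
theorem toLim_injective_of_res_injective (J : Subgroup P) (hJ : J.FiniteIndex) (hJo : IsOpen (J : Set P))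
    (hinj : ∀ K : Subgroup P, K.FiniteIndex → IsOpen (K : Set P) → ∀ hKJ : K ≤ J,
      Function.Injective (ContH1.res φ A (inf_le_inf_left H hKJ))) :
    Function.Injective ((cohomologySystemOfContH1 φ A H).toLim J) := by
  haveI := Idx.isDirected (P := P) (⊥ : Subgroup P)
  haveI : Nonempty (Idx (P := P) (⊥ : Subgroup P)) := ⟨Idx.top ⊥⟩
  haveI : DirectedSystem (Gmod φ A H ⊥) fun i j hij => fmod φ A H ⊥ i j hij := directedSystem φ A H ⊥
  rw [injective_iff_map_eq_zero]
  intro x hx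
  -- write `x = e⁻¹ y` for the comparison `H1 J ≅ H¹(H ⊓ J, A)`
  set e := h1EquivOfFiniteIndexOpen φ A H J hJ hJo with he
  obtain ⟨y, rfl⟩ : ∃ y, x = e.symm y := ⟨e x, (e.symm_apply_apply x).symm⟩
  rw [toLim_h1Equiv_symm] at hx
  obtain ⟨j, hij, hj⟩ := AddCommGroup.DirectLimit.of.zero_exact (G := Gmod φ A H ⊥) (f := fmod φ A H ⊥)
    ((Idx.self J hJ hJo).incl bot_le) y hx
  -- the transition map out of the index `J` is the restriction `H¹(H ⊓ J) → H¹(H ⊓ K_j)`, injective by `hinj`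
  have hKJ : j.K ≤ J := Idx.le_iff.mp hij
  have hres : ContH1.res φ A (inf_le_inf_left H hKJ) (Additive.toMul y) = 1 := by
    have := congrArg Additive.toMul hj
    exact this
  have hy : Additive.toMul y = 1 :=
    hinj j.K (OrderDual.ofDual j).2.1 (OrderDual.ofDual j).2.2.1 hKJ (by rw [hres, map_one])
  have hy' : y = 0 := congrArg Additive.ofMul hy
  rw [hy', map_zero]
  rfl

omit [IsTopologicalGroup G'] in
/-- `H ⊓ K₀` is normal in `H ⊓ J` when `K₀` is normal in the ambient group. [cite: NeukirchSchmidtWingberg2008, I §6] -/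
private theorem inf_subgroupOf_inf_normal_of_normal (J K₀ : Subgroup P) [hK₀ : K₀.Normal] :
    ((H ⊓ K₀).subgroupOf (H ⊓ J)).Normal := by
  refine ⟨fun n hn g => ?_⟩
  rw [Subgroup.mem_subgroupOf] at hn ⊢
  refine ⟨H.mul_mem (H.mul_mem g.2.1 hn.1) (H.inv_mem g.2.1), ?_⟩
  exact hK₀.conj_mem _ hn.2 _

/-- INFLATION–RESTRICTION via the normal core: the restriction `H¹(H ⊓ J, A) → H¹(H ⊓ K, A)` (`K ⊆ J` of finite
index) is injective whenever no element of `A` other than `1` is fixed by `H ⊓ K'` for every finite-index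
subgroup `K'` — apply abc-iut-w4-d041's `ContH1.res_injective_of_forall_fixed_eq_one` to the normal core
`K₀ ⊴ Π` of `K` (finite index, `H ⊓ K₀ ⊴ H ⊓ J`) and factor `res_{J→K₀} = res_{K→K₀} ∘ res_{J→K}`.
[cite: NeukirchSchmidtWingberg2008, I §6] -/
theorem res_injective_of_forall_finiteIndex_fixed_eq_one (J K : Subgroup P) [K.FiniteIndex] (hKJ : K ≤ J)
    (hfix : ∀ K' : Subgroup P, K'.FiniteIndex →
      ∀ a : A, (∀ n : P, n ∈ H ⊓ K' → MulAut.conjNormal (φ n) a = a) → a = 1) :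
    Function.Injective (ContH1.res φ A (inf_le_inf_left H hKJ)) := by
  -- the normal core `K₀ ⊴ Π`, `K₀ ≤ K`, of finite index
  have hK₀K : K.normalCore ≤ K := Subgroup.normalCore_le K
  have h₀ : H ⊓ K.normalCore ≤ H ⊓ K := inf_le_inf_left H hK₀K
  have h₀J : H ⊓ K.normalCore ≤ H ⊓ J := h₀.trans (inf_le_inf_left H hKJ)
  have hinj₀ : Function.Injective (ContH1.res φ A h₀J) :=
    ContH1.res_injective_of_forall_fixed_eq_one h₀J (inf_subgroupOf_inf_normal_of_normal H J K.normalCore)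
      (hfix K.normalCore inferInstance)
  -- `res_{J→K₀} = res_{K→K₀} ∘ res_{J→K}`
  have hcomp : (fun x => ContH1.res φ A h₀ (ContH1.res φ A (inf_le_inf_left H hKJ) x)) =
      fun x => ContH1.res φ A h₀J x := by
    funext x
    exact ContH1.res_res _ _ x
  have hinj' : Function.Injective
      (fun x => ContH1.res φ A h₀ (ContH1.res φ A (inf_le_inf_left H hKJ) x)) := by
    rw [hcomp]; exact hinj₀
  exact Function.Injective.of_comp hinj'

/-- Hence: `toLim ⊤ : H¹(H, A) (= H1 ⊤) → lim_J H¹(H|_J, A)` is INJECTIVE whenever `A` has no nontrivial element fixed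
by `H ⊓ K'` for any finite-index `K' ≤ Π` — in particular its kernel consists of torsion (indeed zero) classes.
[cite: Mochizuki2012, Prop 1.4 p.27] -/
theorem toLim_top_injective_of_forall_fixed_eq_one
    (hfix : ∀ K' : Subgroup P, K'.FiniteIndex →
      ∀ a : A, (∀ n : P, n ∈ H ⊓ K' → MulAut.conjNormal (φ n) a = a) → a = 1) :
    Function.Injective ((cohomologySystemOfContH1 φ A H).toLim ⊤) :=
  toLim_injective_of_res_injective φ A H ⊤ inferInstance (by simp) fun K hK _ hKJ => by
    haveI := hK
    exact res_injective_of_forall_finiteIndex_fixed_eq_one φ A H ⊤ K hKJ hfix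

/-- Kernel form consumed by `IotaInvariantTheta'.inftyClause_of_ker_torsion`: under the fixed-point hypothesis
every class killed by `toLim ⊤` is torsion (it is `0`). [cite: Mochizuki2012, Prop 1.4 p.27] -/
theorem toLim_top_ker_torsion_of_forall_fixed_eq_one
    (hfix : ∀ K' : Subgroup P, K'.FiniteIndex →
      ∀ a : A, (∀ n : P, n ∈ H ⊓ K' → MulAut.conjNormal (φ n) a = a) → a = 1)
    (y : (cohomologySystemOfContH1 φ A H).H1 ⊤) (hy : (cohomologySystemOfContH1 φ A H).toLim ⊤ y = 0) :
    IsOfFinAddOrder y := by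
  have : y = 0 := toLim_top_injective_of_forall_fixed_eq_one φ A H hfix (by rw [hy, map_zero])
  rw [this]
  exact IsOfFinAddOrder.zero

end ToLim

/-! ## The «respectively» clause of Prop. 2.2 (ii) at the model `D := etaleThetaDataOfSetting'` -/

section Model

open EtaleThetaDataOfSetting

variable {p : ℕ} [Fact p.Prime] {D : Literature.AnabelianGeometry.EtaleTheta.ThetaSetting p}
  {E : D.EtaleThetaData} {l : ℕ} (C : E.DoubleUnderline l)

/-- **IUTchII:Prop2.2(ii)** «respectively» clause, clauses (1)(2), AT THE MODEL `Π_v := Π^tp_X̲̲` of [EtTh] §2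
(`D := etaleThetaDataOfSetting'`, abc-iut-L6-t1): for every decomposition datum and every `IotaInvariantTheta'`
datum over it, `∞θ^ι(Π_v)` is nonempty and any two members with a common root level differ by a torsion class,
GIVEN (hfix) `(l·Δ_Θ)(Π_v)` has no nontrivial element fixed by `Π_Ÿ(Π_v) ∩ K'` for any finite-index `K' ≤ Π_v` — the
binder `hker` of `inftyClause_uniqueness_of_ker_torsion` being DISCHARGED by
`toLim_top_ker_torsion_of_forall_fixed_eq_one`. [claim: Mochizuki2012, status: disputed]
(IUTchII §2 Prop 2.2 (ii), kurims p.66) -/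
theorem inftyClause_uniqueness_etaleThetaDataOfSetting' (hC : D.Compat) (hS : D.Sec2Hyps)
    (hchar : PiYddCharacteristic C) (S : BadPlaceSetting.{0}) (eS : (Pi C) ≃ₜ* S.PiX) (hl : S.l = l)
    {T : TemperedCoverings S (Pi C)}
    {Dec : SubgraphDecomposition S T (etaleThetaDataOfSetting' C hC hS hchar S.toThetaSetting eS hl)}
    (Θ : IotaInvariantTheta' Dec)
    (hfix : ∀ K' : Subgroup (Pi C), K'.FiniteIndex → ∀ a : ↥(D.lDeltaTheta l),
      (∀ n : Pi C, n ∈ PiYdd C ⊓ K' → MulAut.conjNormal (phi C n) a = a) → a = 1) :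
    Θ.thetaInftyIota.Nonempty ∧
      ∀ x ∈ Θ.thetaInftyIota, ∀ x' ∈ Θ.thetaInftyIota,
        (etaleThetaDataOfSetting' C hC hS hchar S.toThetaSetting eS hl).SameRootLevel x x' →
          IsOfFinAddOrder (x - x') :=
  Θ.inftyClause_uniqueness_of_ker_torsion
    (toLim_top_ker_torsion_of_forall_fixed_eq_one (phi C) (D.lDeltaTheta l) (PiYdd C) hfix)

/-- **IUTchII:Prop2.2(ii)** «respectively» clause, IN FULL, AT THE MODEL: `InftyClause` holds for every
`IotaInvariantTheta'` datum over `etaleThetaDataOfSetting'`, given (hfix) as above — which DISCHARGES `hker` — and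
(hdiv) the divisibility of the classes of `θ(Π_v)` in `lim_J H¹(Π_Ÿ(Π_v)|_J, (l·Δ_Θ)(Π_v))` (Kummer theory on the
tempered coverings; L2 input, by name). [claim: Mochizuki2012, status: disputed]
(IUTchII §2 Prop 2.2 (ii), kurims p.66) -/
theorem inftyClause_etaleThetaDataOfSetting' (hC : D.Compat) (hS : D.Sec2Hyps)
    (hchar : PiYddCharacteristic C) (S : BadPlaceSetting.{0}) (eS : (Pi C) ≃ₜ* S.PiX) (hl : S.l = l)
    {T : TemperedCoverings S (Pi C)}
    {Dec : SubgraphDecomposition S T (etaleThetaDataOfSetting' C hC hS hchar S.toThetaSetting eS hl)}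
    (Θ : IotaInvariantTheta' Dec)
    (hfix : ∀ K' : Subgroup (Pi C), K'.FiniteIndex → ∀ a : ↥(D.lDeltaTheta l),
      (∀ n : Pi C, n ∈ PiYdd C ⊓ K' → MulAut.conjNormal (phi C n) a = a) → a = 1)
    (hdiv : ∀ t ∈ (etaleThetaDataOfSetting' C hC hS hchar S.toThetaSetting eS hl).theta, ∀ N : ℕ, 0 < N →
      ∃ x : (coh C).lim, N • x = (coh C).toLim ⊤ t) :
    Θ.InftyClause :=
  Θ.inftyClause_of_ker_torsion
    (toLim_top_ker_torsion_of_forall_fixed_eq_one (phi C) (D.lDeltaTheta l) (PiYdd C) hfix) hdiv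

end Model

end

end Literature.IUT.HodgeArakelov
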